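import Summits.Ventures.Crystal3D.Theorems.StickyWulffConstantGenericWallFloorHRowWalk
import Summits.Ventures.Crystal3D.Theorems.StickyWulffConstantGenericWallFloorStackLedgerLocalTools
import HarnessLib

/-!
# `HRowEndFar`: the named local input (J-b) of the LAYER ROWS line — no rising certified walker state at an h-row END ball
# (crux `GenericWallFloor`, stmt-Ventures-19480, kernel G; cf-p1 RULING (ccxii)(A) TRACK 1 «named certified hypothesis of R1», shape posted by the
#  machine owner 19480-p2 g13 2026-08-29T12:2xZ with the co-axiality caveat)

HONEST FRAMING. Venture `Summits/Ventures/Crystal3D` (cell `crystal3d-full`), route `route-Ventures-StickyWulffConstant`, helper for the crux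
`GenericWallFloor` (stmt-Ventures-19480) / consumer `TextureLiminfV5` (stmt-Ventures-23912).  ONE definition (a named hypothesis, NOT proved here) and
its unpacking; standard axioms; F-C1 not moved.

THE POINT.  LAYER ROWS counts c-rows (stack walk, in-plane steep bottom) and h-rows (`hRowStep`) as one family; the per-ball payer count needs that an
h-row END ball `e` (its in-plane predecessor `e − F u` h-FULL, its own h-dozen not full) carries no OTHER end state.  The one-family machinery of the
stack ledger excludes coincident tops by NON-co-axiality + the certified covering inputs `DoubleStarCoaxialAt` / `CapPairCoaxial`; that route does not
transfer: an inclined twin frame `R_n L₁` IS co-axial with `L₁` in their sense (common Barlow frame along `n`).  What the owner's falsifiers show instead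
(kit j330741: chain frames to depth 5, 0 rising arrivals among 144 feasible; j330576/j330591: 2×100k generic frames, every feasible arrival has
`cos(step, u) ≤ −0.835`, max admissible rise `−0.26 < 3/8`) is the stronger, depth-free, direction-aware statement:
* **`HRowEndFar`** — in a `1`-separated `X`, at a ball `e` whose in-plane predecessor `e − F u` is h-full and whose own h-dozen `e + F·hcpSlots` is not
  full, NO strongly certified walker state `⟨F′, q, 0⟩` (`WalkCertified12`: full or cap predecessor along `q`) has a direction rising by `≥ 3/8` along a
  unit vertical `ζ` for which the row direction is steep (`⟪F u, ζ⟫ ≥ √2/2`).  Its bottom-level instance (`F′ = F`, `q = u`, no rise needed) is the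
  theorem `not_walkCertified_bottom_of_hFull` (…HRowNoBottomState); the rest ((J-b), pushed levels) is the NAMED INPUT, to be certified (cf-p2: interval
  B&B over `SO(3) × slots × {full, caps}` against the rigid 14-ball h-side) or proved structurally (TRACK 2).
* `HRowEndFar.not_certified12` — the unpacked form at an h-row END in the machine's variables (`HRowInv` + `hRowStep = none`).
WHAT THIS IS NOT: no proof of `HRowEndFar`; no count; F-C1 not moved.
-/

noncomputable section

namespace Summit.Ventures.Crystal3D.Theorems

open Finset
open scoped InnerProductSpace

/-- **`HRowEndFar` — NO RISING CERTIFIED WALKER STATE AT AN h-ROW END BALL** (named input (J-b) of the LAYER ROWS line).  For frames `F, F′`, an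
in-plane slot `u`, a slot `q`, a unit vertical `ζ` with `⟪F u, ζ⟫ ≥ √2/2` and `⟪F′ q, ζ⟫ ≥ 3/8`, a `1`-separated `X` and a ball `e ∈ X` whose predecessor
`e − F u` is in `X` and h-FULL while `e`'s own h-dozen is not full: the state `⟨F′, q, 0⟩` is NOT strongly certified at `e`. -/
def HRowEndFar : Prop :=
  ∀ (F F' : EuclideanSpace ℝ (Fin 3) ≃ₗᵢ[ℝ] EuclideanSpace ℝ (Fin 3)), ∀ u ∈ fccSlots, u 2 = 0 → ∀ q ∈ fccSlots,
    ∀ ζ : EuclideanSpace ℝ (Fin 3), ‖ζ‖ = 1 → Real.sqrt 2 / 2 ≤ ⟪F u, ζ⟫_ℝ → (3 : ℝ) / 8 ≤ ⟪F' q, ζ⟫_ℝ →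
    ∀ X : Finset (EuclideanSpace ℝ (Fin 3)), (∀ p ∈ X, ∀ p' ∈ X, p ≠ p' → 1 ≤ dist p p') →
    ∀ e ∈ X, e - F u ∈ X → (∀ s ∈ hcpSlots, e - F u + F s ∈ X) → (∃ s ∈ hcpSlots, e + F s ∉ X) →
      ¬ WalkCertified12 X e ⟨F', q, 0⟩

/-- **Unpacking at an h-row END** (machine variables): under `HRowEndFar`, a ball at which the h-row walk of `(F, u)` has arrived (`HRowInv`) and stops
(`hRowStep = none`) carries no strongly certified state `⟨F′, q, 0⟩` whose direction rises `≥ 3/8` along a vertical making `F u` steep. -/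
theorem HRowEndFar.not_certified12 (hJ : HRowEndFar) {X : Finset (EuclideanSpace ℝ (Fin 3))}
    (hX : ∀ p ∈ X, ∀ p' ∈ X, p ≠ p' → 1 ≤ dist p p')
    {F F' : EuclideanSpace ℝ (Fin 3) ≃ₗᵢ[ℝ] EuclideanSpace ℝ (Fin 3)} {u q ζ y : EuclideanSpace ℝ (Fin 3)}
    (hu : u ∈ fccSlots) (hu2 : u 2 = 0) (hq : q ∈ fccSlots) (hζ : ‖ζ‖ = 1) (hsteep : Real.sqrt 2 / 2 ≤ ⟪F u, ζ⟫_ℝ)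
    (hrise : (3 : ℝ) / 8 ≤ ⟪F' q, ζ⟫_ℝ) (hI : HRowInv X F u y) (hstop : hRowStep X F u y = none) :
    ¬ WalkCertified12 X y ⟨F', q, 0⟩ :=
  hJ F F' u hu hu2 q hq ζ hζ hsteep hrise X hX y hI.1 hI.2.1 hI.2.2 (not_full_of_hRowStep_eq_none F hstop)

end Summit.Ventures.Crystal3D.Theorems

end
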